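import Summits.BirchSwinnertonDyer.BirchSwinnertonDyer.Theorems.ManinLocalTwoThreeAtkinLehnerStep
import Summits.BirchSwinnertonDyer.BirchSwinnertonDyer.Theorems.ManinLocalTwoThreeHeckeAdAtkinLehner
import HarnessLib

/-!
# E-es-42 `AtkinLehnerStep` UNCONDITIONALLY: σ2 discharged (MEMO-es §25.3 (V-b), §25.6 σ2)

Summit `BirchSwinnertonDyer`, route `ManinLocalTwoThree` (cell bsd-f2-manin), crux C2 `ManinOddAtFour` (stmt-BirchSwinnertonDyer-22967),
line `kato_shift_two` v6, stub 3 (`C₃`-image residual).  The lead's `atkinLehnerStep_of_sigma2 (p t) (hσ2)` (p605637,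
`Theorems/ManinLocalTwoThreeAtkinLehnerStep.lean`) proves es's E-es-42 modulo the hypothesis σ2 «every Atkin–Lehner pull-back
`u ∘ Ad(W)` of a generalised `λ`-eigen cocycle off `S` is again one».  Here σ2 is DISCHARGED from the commutation identity
`heckeU_zero_comp_atkinLehner` (p605902): for `t ∈ S` (so every Hecke prime `ℓ ∉ S` has `ℓ ≠ t`) the pull-back `v ↦ v ∘ Φ` is an
endomorphism of `Z⁰(Γ₀(L′t), K)` commuting with `T_ℓ`, hence preserves the generalised `λ(ℓ)`-eigenspaces
(`isHeckeGenEigenvector_comp_atkinLehner`), and **`atkinLehnerStep_holds (p t)`** is the body of `EsG12.AtkinLehnerStep p t` verbatim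
(defs unfolded exactly as in the lead's file), with no extra hypothesis.  No new definitions; nothing about BSD or Manin's conjecture
is proved here.

References: A. O. L. Atkin, J. Lehner, Math. Ann. 185 (1970), Lemma 11; G. Shimura (1971) §8.3 (8.3.2) [cite: Shimura1971, §8.3 (8.3.2)];
cell memo HOME/MEMO-es.md §25.3 (V-b), §25.6 σ2; cell INBOX 2026-08-28T04:37:05Z (lead: the hσ2 shape).
-/

set_option autoImplicit false
set_option linter.dupNamespace false

open scoped MatrixGroups

open CongruenceSubgroup Matrix.SpecialLinearGroup Literature.NumberTheory.EllipticCurves.ModularForms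
  Literature.NumberTheory.EllipticCurves.ModularForms.HidaCohomology

namespace Summit.BirchSwinnertonDyer.BirchSwinnertonDyer.Theorems.ManinLocalTwoThree

section Sigma2

variable {L' t : ℕ} (ht : t.Prime) (htL : ¬ t ∣ L') (h : Gamma0 L') (hht : (t : ℤ) ∣ (h : SL(2, ℤ)) 0 0)
include ht htL hht

/-- **σ2 (generalised-eigenvector form).**  For `t` prime, `t ∤ L′`, `h ∈ Γ₀(L′)` with `t ∣ h₀₀`, a homomorphism
`Φ : Γ₀(L′t) →* Γ₀(L′t)` with `hγh⁻¹ = A_t (Φγ) A_t⁻¹` on entries (`Φ = Ad(W)`), and `t ∈ S`: if `u` is a generalised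
`λ`-eigenvector off `S` then so is `u ∘ Φ`. [cite: Shimura1971, §8.3 (8.3.2)] -/
theorem isHeckeGenEigenvector_comp_atkinLehner [NeZero L'] [NeZero t] {K : Type*} [Field K] (S : Finset ℕ)
    (htS : t ∈ S) (lam : ℕ → K) (u : cocycles 0 (L' * t) K) (hgen : IsHeckeGenEigenvector S lam u)
    (Φ : Gamma0 (L' * t) →* Gamma0 (L' * t))
    (hΦ : ∀ γ : Gamma0 (L' * t),
      ((h : SL(2, ℤ)) * (γ : SL(2, ℤ)) * (h : SL(2, ℤ))⁻¹) 0 0 = (Φ γ : SL(2, ℤ)) 0 0 ∧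
      ((h : SL(2, ℤ)) * (γ : SL(2, ℤ)) * (h : SL(2, ℤ))⁻¹) 0 1 = (t : ℤ) * (Φ γ : SL(2, ℤ)) 0 1 ∧
      (t : ℤ) * ((h : SL(2, ℤ)) * (γ : SL(2, ℤ)) * (h : SL(2, ℤ))⁻¹) 1 0 = (Φ γ : SL(2, ℤ)) 1 0 ∧
      ((h : SL(2, ℤ)) * (γ : SL(2, ℤ)) * (h : SL(2, ℤ))⁻¹) 1 1 = (Φ γ : SL(2, ℤ)) 1 1)
    (huΦ : (fun γ ↦ (u : Gamma0 (L' * t) → Fin 1 → K) (Φ γ)) ∈ cocycles 0 (L' * t) K) :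
    IsHeckeGenEigenvector S lam ⟨_, huΦ⟩ := by
  classical
  intro ℓ _ hℓ hℓS
  have hℓt : ℓ ≠ t := fun e ↦ hℓS (e ▸ htS)
  -- the pull-back along `Φ` as an endomorphism of the cocycles
  have hC : ∀ v : cocycles 0 (L' * t) K,
      (fun γ ↦ (v : Gamma0 (L' * t) → Fin 1 → K) (Φ γ)) ∈ cocycles 0 (L' * t) K := by
    intro v
    rw [mem_cocycles_iff]
    intro γ δ
    show (v : Gamma0 (L' * t) → Fin 1 → K) (Φ (γ * δ)) =
      (v : Gamma0 (L' * t) → Fin 1 → K) (Φ δ) + act 0 (gmat δ) ((v : Gamma0 (L' * t) → Fin 1 → K) (Φ γ))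
    rw [map_mul, (mem_cocycles_iff.mp v.2) (Φ γ) (Φ δ)]
    simp only [act_zero_eq_id, LinearMap.id_apply]
  let C : Module.End K (cocycles 0 (L' * t) K) :=
    { toFun := fun v ↦ ⟨fun γ ↦ (v : Gamma0 (L' * t) → Fin 1 → K) (Φ γ), hC v⟩
      map_add' := fun _ _ ↦ rfl
      map_smul' := fun _ _ ↦ rfl }
  have hcomm : Commute (heckeUZ 0 (L' * t) K hℓ) C := by
    refine LinearMap.ext fun v ↦ Subtype.ext (funext fun γ ↦ ?_)
    show heckeU 0 (L' * t) K hℓ (fun δ ↦ (v : Gamma0 (L' * t) → Fin 1 → K) (Φ δ)) γ =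
      heckeU 0 (L' * t) K hℓ (v : Gamma0 (L' * t) → Fin 1 → K) (Φ γ)
    exact heckeU_zero_comp_atkinLehner ht htL h hht hℓ hℓt Φ hΦ v.2 γ
  have e : (⟨_, huΦ⟩ : cocycles 0 (L' * t) K) = C u := rfl
  rw [e]
  exact Module.End.mapsTo_maxGenEigenspace_of_comm hcomm (lam ℓ) (hgen ℓ hℓ hℓS)

end Sigma2

section AtkinLehner

/-- **E-es-42 `AtkinLehnerStep p t`, unconditionally** — the body of es's `EsG12.AtkinLehnerStep p t` (HOME/es/Sketch-es-g12.lean)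
with `NotTrivialEisensteinAt`, `KillsCuspsZeroInfty`, `IsShiftConj` unfolded exactly as in the lead's `atkinLehnerStep_of_sigma2`,
whose hypothesis σ2 is now supplied by `isHeckeGenEigenvector_comp_atkinLehner` (`t ∈ S` from the prime-support hypothesis):
a `t`-shift-invariant generalised eigen-homomorphism on `Γ₀(L′t)` with hNT(`t`) satisfies `u β = u γ` whenever
`hγh⁻¹ = diag(t,1) β diag(t,1)⁻¹`, `h ∈ Γ₀(L′)`, `t ∣ a_h`. [cite: Shimura1971, §8.3 (8.3.2)] -/
theorem atkinLehnerStep_holds (p t : ℕ) :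
    p.Prime → t.Prime →
    ∀ (K : Type) [Field K] [CharP K p] (L' : ℕ) [NeZero L'] [NeZero t], ¬ t ∣ L' →
    ∀ (S : Finset ℕ) (lam : ℕ → K) (u : cocycles 0 (L' * t) K),
      (∀ q : ℕ, q.Prime → q ∣ p * t * L' → q ∈ S) →
      IsHeckeGenEigenvector S lam u →
      (∀ M : ℕ, ∃ r : ℕ, r.Prime ∧ r ∉ S ∧ r ≡ 1 [MOD t ^ M] ∧ lam r ≠ (r : K) + 1) →
      ((∀ γ : Gamma0 (L' * t), mapGL ℚ (γ : SL(2, ℤ)) • (OnePoint.infty : OnePoint ℚ) = OnePoint.infty →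
          (u : Gamma0 (L' * t) → Fin 1 → K) γ = 0) ∧
        (∀ γ : Gamma0 (L' * t), mapGL ℚ (γ : SL(2, ℤ)) • ((0 : ℚ) : OnePoint ℚ) = ((0 : ℚ) : OnePoint ℚ) →
          (u : Gamma0 (L' * t) → Fin 1 → K) γ = 0)) →
      degeneracyPullback 0 (L' * t) (L' * t * t) t K dvd_rfl (u : Gamma0 (L' * t) → Fin 1 → K) =
        degeneracyPullback 0 (L' * t) (L' * t * t) 1 K (by simp) (u : Gamma0 (L' * t) → Fin 1 → K) →
      ∀ h : Gamma0 L', (t : ℤ) ∣ (h : SL(2, ℤ)) 0 0 →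
      ∀ γ β : Gamma0 (L' * t),
        (((h : SL(2, ℤ)) * (γ : SL(2, ℤ)) * (h : SL(2, ℤ))⁻¹) 0 0 = (β : SL(2, ℤ)) 0 0 ∧
          ((h : SL(2, ℤ)) * (γ : SL(2, ℤ)) * (h : SL(2, ℤ))⁻¹) 0 1 = (t : ℤ) * (β : SL(2, ℤ)) 0 1 ∧
          (t : ℤ) * ((h : SL(2, ℤ)) * (γ : SL(2, ℤ)) * (h : SL(2, ℤ))⁻¹) 1 0 = (β : SL(2, ℤ)) 1 0 ∧
          ((h : SL(2, ℤ)) * (γ : SL(2, ℤ)) * (h : SL(2, ℤ))⁻¹) 1 1 = (β : SL(2, ℤ)) 1 1) →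
        (u : Gamma0 (L' * t) → Fin 1 → K) β = (u : Gamma0 (L' * t) → Fin 1 → K) γ := by
  intro _ ht K _ _ L' _ _ hL' S lam u hS hgen hNT _ hshift h hth γ β hβ
  obtain ⟨Φ, hΦ⟩ := exists_atkinLehnerHom t L' ht.ne_zero h hth
  have htS : t ∈ S := hS t ht (dvd_mul_of_dvd_left (dvd_mul_left t p) L')
  have hinv := atkinLehner_invariant_of_heckeGenEigen ht hL' S lam u hS hgen hNT hshift h Φ hΦ
    (fun huΦ ↦ isHeckeGenEigenvector_comp_atkinLehner ht hL' h hth S htS lam u hgen Φ hΦ huΦ)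
  have hβΦ : β = Φ γ := Subtype.ext (shiftConj_unique ht.ne_zero hβ (hΦ γ))
  rw [hβΦ]
  exact hinv γ

end AtkinLehner

end Summit.BirchSwinnertonDyer.BirchSwinnertonDyer.Theorems.ManinLocalTwoThree
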